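import Literature.Barriers.Parity.WeightedSieveLimit
import Literature.Barriers.Parity.LinearSieveOptimalityRemainder

/-!
# Discharge of named literature fact(s) by composition

This file only composes reductions and discharges that are already in the tree
(no new definitions, no new named facts): each `theorem X_holds : X` below feeds the
proved hypotheses into an existing reduction theorem.  Net effect: the listed facts
stop being literature debt.
-/

namespace Literature.Barriers.Parity

/-- Discharge of `WeightedSieveLimit` from the proved remainder estimate
`Greaves2001_selbergSet_remainder_holds` via `weightedSieveLimit_of_remainder`.
[cite: Greaves2001, PDF pp. 136–137 and §4.5.1 (1.1)–(1.4)] -/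
theorem WeightedSieveLimit_holds : WeightedSieveLimit :=
  weightedSieveLimit_of_remainder Greaves2001_selbergSet_remainder_holds

end Literature.Barriers.Parity
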